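import Summits.QuantumFields.YangMills.Theorems.BalabanUVNodesN15SiteColouredLayer
import Summits.QuantumFields.YangMills.Theorems.BalabanUVNodesN15SiteColouredWordsF
import HarnessLib

/-!
# Route «BalabanUVNodes», cluster K4 «SpineRates» — node N15 = NE2: THE SITE LAYER WITH THE BACKGROUND LIVE IN THE TwoGrid ENTRY CURRENCY, XXVI — PART XXIII WITH THE COLOURED AVERAGING
# SPECIES LIVE: the coloured socket's three letters and `NE2PlusSite` (every colour entry, size live) from a matrix species' three letters AND a coloured averaging species' six letters, read at
# size — part XVIII on the coloured carrier

Cell `pub-ymgap`, WIDTH SEAT `pub-ymgap-dag-n15-w1` (generation 3; director-ym №197 ∕ HUMAN RULING D-0149; chair R455 (A) ∕ R461; plan g83 `W-SEAT-START-LIST.md` v11 §n15; (αγ) step 2).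
`bears_on: R4∕N15 · K3⁷ SpineGivenEndpointR13SepCoPH (stmt-QuantumFields-20544)`.  Filed `--kind proof --supports stmt-QuantumFields-20544 --as helper` — COUNT-NEUTRAL.  THEOREMS ONLY (0 `def`,
0 `sorry`).  Imports BY NAME this seat's part XXIII `…N15SiteColouredLayer` (`tensorId_massless_letters`, through it parts XXI∕XXII, S4, `bgConst`) and part XXV `…N15SiteColouredWordsF`
(`siteLettersCF_of_sizedDressedLetters`; through it part XVIII `sitePertF_sizeConst_le`∕`sitePertF_fitConst_le`); nothing in the tree is modified.

CONTENTS.  §1 ★★★ `siteLettersCF_of_sizedSpeciesLettersM` (part XXIII §2's proof with part XXV's words; threshold `a₁ ∧ a₂ ∧ (2βKc_r + 1)⁻¹`); §2 ★★★ `ne2PlusSite_cSiteExOn_of_sizedSpeciesLettersMF`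
(part XXI's socket ∘ §1).

HONEST FRAMING.  Count-neutral, species-independent BRIDGE; no new estimate; BOTH species are BINDERS here (the sequel inhabits them at FILE 40's family).  NOT [B9] Thm 3.2 at a general
(3.35)-regular `U` (NE2⁺ NOT PRINTED as an η-rate); Node 00's [B9] layers of record are residual — **N15 is NOT discharged** (typed 28∕28 · discharged 5∕27 of record unchanged); K3⁷ OPEN,
its N15 pin untouched; one finite four-torus programme at fixed `ε` — NOT ℝ⁴, NOT infinite volume, NOT OS, NOT a mass gap, NOT Clay; R4 closes the conditional finite-𝕋⁴ rung `BalabanLadder.UV`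
only.  Restate-immune.
-/


set_option autoImplicit false

noncomputable section

open scoped BigOperators Matrix
open Finset

namespace Summit.QuantumFields.YangMills.BalabanUVNodes.N15.SiteLayerBg

open Literature.MathematicalPhysics.QuantumFieldTheory.Balaban1983to89
open Literature.MathematicalPhysics.QuantumFieldTheory.Balaban1983to89.B11SectG (BlockNorm HasMaj RowSum)
open Literature.MathematicalPhysics.QuantumFieldTheory.Balaban1983to89.T4EtaRate (PairedInstance EtaPairing NE2PlusSite)
open Literature.MathematicalPhysics.QuantumFieldTheory.Balaban1983to89.T4EtaRateDefect (idef)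
open Literature.MathematicalPhysics.QuantumFieldTheory.Balaban1983to89.T4EtaRateCoeffDefect (pull diagK diagK_nonneg diagK_mono fibre)
open Literature.MathematicalPhysics.QuantumFieldTheory.Balaban1983to89.B5Prop11Plancherel (Tor fine)
open Literature.MathematicalPhysics.QuantumFieldTheory.Balaban1983to89.B4Sect5Torus (tdist)
open Literature.MathematicalPhysics.QuantumFieldTheory.Balaban1983to89.B4Sect5Proof (latticeConst latticeConst_nonneg)
open Literature.MathematicalPhysics.QuantumFieldTheory.Balaban1983to89.B5QGGQ145Bounds (Idx)
open Literature.MathematicalPhysics.QuantumFieldTheory.Balaban1983to89.B6UnitTorusCarrier (unitTorusGeo triangle254_unitTorusGeo rowSum_unitTorusGeo)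
open Literature.MathematicalPhysics.QuantumFieldTheory.Balaban1983to89.B9SectDSup (inv_one_sub_le_two)
open Literature.MathematicalPhysics.QuantumFieldTheory.King1986 (aK aK_pos)
open Literature.MathematicalPhysics.QuantumFieldTheory.King1986.Torus (fineOp blockOf tdistT tdistT_nonneg)
open Summit.QuantumFields.YangMills.BalabanUVNodes.N15.VectorPiece (unitTorusGeoS unitTorusGeoS_dist tensorId hasMaj_tensorId idef_tensorId)
open Summit.QuantumFields.YangMills.BalabanUVNodes.N15.MatrixSpecies (liftMap liftBlk)
open Summit.QuantumFields.YangMills.BalabanUVNodes.N15.OperatorReadout (opGeo)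
open Summit.QuantumFields.YangMills.BalabanUVNodes.N15.BackgroundLayer (blkPair liftPair bgConst bgConst_nonneg)
open Summit.QuantumFields.YangMills.BalabanUVNodes.N15.SiteLayer (siteForm dressedOp hasMaj_dressedOp hasMaj_dressedOp_sub hasMaj_idef_dressedOp)
open Summit.QuantumFields.YangMills.BalabanUVNodes.N15KingModelRung.Curved (kingGOp kingDOp underPtN)

variable {d : ℕ} {L : ℕ} [NeZero L] {I : Type}

/-! ## §1 ★★★ The coloured socket's sized letters from the two coloured species' letters read at size -/

section LettersMF

variable (ι : Type) [Fintype ι] [DecidableEq ι] (Mn : I → Fin (d + 1) → ℕ) [hMn0 : ∀ i μ, NeZero (Mn i μ)] (kk mm : I → ℕ) (Msz : I → ℝ) (Bc Bf : I → B9.Backgrounds)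
  (avg : ∀ i, (Bf i).Cfg → (Bc i).Cfg)
  (Vc : ∀ i, (Bc i).Cfg → (((Tor (fine (L ^ kk i) (Mn i)) × ι) × Option (Fin (d + 1)) → ℝ) →ₗ[ℝ] (Tor (fine (L ^ kk i) (Mn i)) × ι → ℝ)))
  (Vf : ∀ i, (Bf i).Cfg → (((Tor (fine (L ^ mm i * L ^ kk i) (Mn i)) × ι) × Option (Fin (d + 1)) → ℝ) →ₗ[ℝ] (Tor (fine (L ^ mm i * L ^ kk i) (Mn i)) × ι → ℝ)))
  (Fc : ∀ i, (Bc i).Cfg → (Tor (fine (L ^ kk i) (Mn i)) × ι → ℝ) →ₗ[ℝ] (Tor (Mn i) × ι → ℝ)) (Fsc : ∀ i, (Bc i).Cfg → (Tor (Mn i) × ι → ℝ) →ₗ[ℝ] (Tor (fine (L ^ kk i) (Mn i)) × ι → ℝ))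
  (Ff : ∀ i, (Bf i).Cfg → (Tor (fine (L ^ mm i * L ^ kk i) (Mn i)) × ι → ℝ) →ₗ[ℝ] (Tor (Mn i) × ι → ℝ))
  (Fsf : ∀ i, (Bf i).Cfg → (Tor (Mn i) × ι → ℝ) →ₗ[ℝ] (Tor (fine (L ^ mm i * L ^ kk i) (Mn i)) × ι → ℝ))

set_option maxHeartbeats 400000 in
/-- ★★★ **THE COLOURED SOCKET's SIZED LETTERS, AVERAGING SPECIES LIVE, FROM THE TWO COLOURED SPECIES' LETTERS READ AT SIZE** — part XVIII §1 on the coloured carriers: §2 of part XXIII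
with part XXV's averaging words; HYPOTHESES `hV` (matrix species, three sized diagonal letters) AND `hF` (coloured averaging species: sizes `≤ diagK (r₀ s)` in the frames `liftBlk blockOf ι →
fst`, fits `≤ diagK (o₀(L^k)^{−γ∕2})`, `s ≤ a₂`); CONCLUSION = part XXI's sized `hP` for `Pf∕Pc := siteEntriesC (sitePertCF … F Fs (G′ ⊗ 1) (dressedOp (G′ ⊗ 1) (D ⊗ 1) V̂))`; `r = r₀s ≤ r₀a₂` frozen
in the `(1 + r)` factors (part XVIII `sitePertF_sizeConst_le` ∕ `sitePertF_fitConst_le`). [cite: Balaban1985BackgroundPropagators, (3.52) p.400, (3.58) p.402, (3.63)–(3.67) pp.402–403 (mechanism), (3.35) p.396 (letters at size); King1986, Prop. 3.8 (3.71) p.664] -/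
theorem siteLettersCF_of_sizedSpeciesLettersM (hLodd : Odd L) (hL2 : 2 ≤ L) {aS : ℝ} (haS : 0 < aS) (c35 : ℝ) {γ : ℝ} (hγ0 : 0 < γ) (hγ1 : γ < 1)
    {mT : I → ℕ} (hMnT : ∀ i μ, Mn i μ = 2 * L ^ mT i) (hk : ∀ i, 1 ≤ kk i) (hm : ∀ i, 1 ≤ mm i)
    (hMsz : ∀ i, 1 ≤ Msz i)
    (hV : ∃ K a₁ : ℝ, 0 ≤ K ∧ 0 < a₁ ∧ ∀ (i : I) (α₀ : ℝ), 0 < α₀ → Msz i * α₀ ≤ a₁ → ∀ U : (Bf i).Cfg, (Bf i).Reg335 c35 α₀ U →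
      HasMaj (BlockNorm.ofBlocks (unitTorusGeoS L (kk i) (Mn i) (Msz i)) (blkPair (liftBlk (blockOf (L ^ kk i) (Mn i)) ι)))
        (BlockNorm.ofBlocks (unitTorusGeoS L (kk i) (Mn i) (Msz i)) (liftBlk (blockOf (L ^ kk i) (Mn i)) ι)) (Vc i (avg i U)) (diagK fun _ => K * (Msz i * α₀)) ∧
      HasMaj (BlockNorm.ofBlocks (unitTorusGeoS L (kk i) (Mn i) (Msz i)) (blkPair (liftBlk (blockOf (L ^ kk i) (Mn i) ∘ underPtN L (kk i) (mm i) (Mn i)) ι)))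
        (BlockNorm.ofBlocks (unitTorusGeoS L (kk i) (Mn i) (Msz i)) (liftBlk (blockOf (L ^ kk i) (Mn i) ∘ underPtN L (kk i) (mm i) (Mn i)) ι)) (Vf i U)
        (diagK fun _ => K * (Msz i * α₀)) ∧
      HasMaj (BlockNorm.ofBlocks (unitTorusGeoS L (kk i) (Mn i) (Msz i)) (blkPair (liftBlk (blockOf (L ^ kk i) (Mn i)) ι)))
        (BlockNorm.ofBlocks (unitTorusGeoS L (kk i) (Mn i) (Msz i)) (liftBlk (blockOf (L ^ kk i) (Mn i) ∘ underPtN L (kk i) (mm i) (Mn i)) ι))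
        (idef (pull (liftPair (liftMap (underPtN L (kk i) (mm i) (Mn i)) ι))) (pull (liftMap (underPtN L (kk i) (mm i) (Mn i)) ι)) (Vf i U) (Vc i (avg i U)))
        (diagK fun _ => K * (Msz i * α₀) * ((L : ℝ) ^ kk i) ^ (-(γ / 2))))
    (hF : ∃ r₀ o₀ a₂ : ℝ, 0 ≤ r₀ ∧ 0 ≤ o₀ ∧ 0 < a₂ ∧ ∀ (i : I) (α₀ : ℝ), 0 < α₀ → Msz i * α₀ ≤ a₂ → ∀ U : (Bf i).Cfg, (Bf i).Reg335 c35 α₀ U →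
      HasMaj (BlockNorm.ofBlocks (unitTorusGeoS L (kk i) (Mn i) (Msz i)) (liftBlk (blockOf (L ^ kk i) (Mn i)) ι)) (BlockNorm.ofBlocks (unitTorusGeoS L (kk i) (Mn i) (Msz i)) (fun p : Tor (Mn i) × ι => p.1))
        (Fc i (avg i U)) (diagK fun _ => r₀ * (Msz i * α₀)) ∧
      HasMaj (BlockNorm.ofBlocks (unitTorusGeoS L (kk i) (Mn i) (Msz i)) (fun p : Tor (Mn i) × ι => p.1)) (BlockNorm.ofBlocks (unitTorusGeoS L (kk i) (Mn i) (Msz i)) (liftBlk (blockOf (L ^ kk i) (Mn i)) ι))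
        (Fsc i (avg i U)) (diagK fun _ => r₀ * (Msz i * α₀)) ∧
      HasMaj (BlockNorm.ofBlocks (unitTorusGeoS L (kk i) (Mn i) (Msz i)) (liftBlk (blockOf (L ^ kk i) (Mn i) ∘ underPtN L (kk i) (mm i) (Mn i)) ι))
        (BlockNorm.ofBlocks (unitTorusGeoS L (kk i) (Mn i) (Msz i)) (fun p : Tor (Mn i) × ι => p.1)) (Ff i U) (diagK fun _ => r₀ * (Msz i * α₀)) ∧
      HasMaj (BlockNorm.ofBlocks (unitTorusGeoS L (kk i) (Mn i) (Msz i)) (fun p : Tor (Mn i) × ι => p.1))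
        (BlockNorm.ofBlocks (unitTorusGeoS L (kk i) (Mn i) (Msz i)) (liftBlk (blockOf (L ^ kk i) (Mn i) ∘ underPtN L (kk i) (mm i) (Mn i)) ι)) (Fsf i U) (diagK fun _ => r₀ * (Msz i * α₀)) ∧
      HasMaj (BlockNorm.ofBlocks (unitTorusGeoS L (kk i) (Mn i) (Msz i)) (liftBlk (blockOf (L ^ kk i) (Mn i)) ι)) (BlockNorm.ofBlocks (unitTorusGeoS L (kk i) (Mn i) (Msz i)) (fun p : Tor (Mn i) × ι => p.1))
        (idef (pull (liftMap (underPtN L (kk i) (mm i) (Mn i)) ι)) LinearMap.id (Ff i U) (Fc i (avg i U))) (diagK fun _ => o₀ * ((L : ℝ) ^ kk i) ^ (-(γ / 2))) ∧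
      HasMaj (BlockNorm.ofBlocks (unitTorusGeoS L (kk i) (Mn i) (Msz i)) (fun p : Tor (Mn i) × ι => p.1))
        (BlockNorm.ofBlocks (unitTorusGeoS L (kk i) (Mn i) (Msz i)) (liftBlk (blockOf (L ^ kk i) (Mn i) ∘ underPtN L (kk i) (mm i) (Mn i)) ι))
        (idef LinearMap.id (pull (liftMap (underPtN L (kk i) (mm i) (Mn i)) ι)) (Fsf i U) (Fsc i (avg i U))) (diagK fun _ => o₀ * ((L : ℝ) ^ kk i) ^ (-(γ / 2)))) :
    ∃ δP ζ τ a₁ : ℝ, 0 < δP ∧ 0 < ζ ∧ 0 < τ ∧ 0 < a₁ ∧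
      ∀ (i : I) (α₀ : ℝ), 0 < α₀ → Msz i * α₀ ≤ a₁ → ∀ U : (Bf i).Cfg, (Bf i).Reg335 c35 α₀ U →
        (∀ p p' : Idx (Mn i) × ι, |siteEntriesC (Mn i) ι (sitePertCF (Mn i) ι (liftMap (blockOf (L ^ kk i) (Mn i)) ι) (Fc i (avg i U)) (Fsc i (avg i U)) (tensorId ι (kingGOp L aS 0 (kk i) (L ^ kk i) (Mn i)))
            (dressedOp (tensorId ι (kingGOp L aS 0 (kk i) (L ^ kk i) (Mn i))) (fun μ => tensorId ι (kingDOp L aS 0 (kk i) (L ^ kk i) (Mn i) μ)) (Vc i (avg i U)))) p p'|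
            ≤ ζ * (Msz i * α₀) * Real.exp (-(δP * tdist (Mn i) p.1 p'.1))) ∧
        (∀ p p' : Idx (Mn i) × ι, |siteEntriesC (Mn i) ι (sitePertCF (Mn i) ι (liftMap (blockOf (L ^ kk i) (Mn i) ∘ underPtN L (kk i) (mm i) (Mn i)) ι) (Ff i U) (Fsf i U)
            (tensorId ι (kingGOp L aS 0 (kk i + mm i) (L ^ mm i * L ^ kk i) (Mn i)))
            (dressedOp (tensorId ι (kingGOp L aS 0 (kk i + mm i) (L ^ mm i * L ^ kk i) (Mn i))) (fun μ => tensorId ι (kingDOp L aS 0 (kk i + mm i) (L ^ mm i * L ^ kk i) (Mn i) μ))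
              (Vf i U))) p p'|
            ≤ ζ * (Msz i * α₀) * Real.exp (-(δP * tdist (Mn i) p.1 p'.1))) ∧
        (∀ p p' : Idx (Mn i) × ι, |siteEntriesC (Mn i) ι (sitePertCF (Mn i) ι (liftMap (blockOf (L ^ kk i) (Mn i) ∘ underPtN L (kk i) (mm i) (Mn i)) ι) (Ff i U) (Fsf i U)
              (tensorId ι (kingGOp L aS 0 (kk i + mm i) (L ^ mm i * L ^ kk i) (Mn i)))
              (dressedOp (tensorId ι (kingGOp L aS 0 (kk i + mm i) (L ^ mm i * L ^ kk i) (Mn i))) (fun μ => tensorId ι (kingDOp L aS 0 (kk i + mm i) (L ^ mm i * L ^ kk i) (Mn i) μ))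
                (Vf i U))) p p'
            - siteEntriesC (Mn i) ι (sitePertCF (Mn i) ι (liftMap (blockOf (L ^ kk i) (Mn i)) ι) (Fc i (avg i U)) (Fsc i (avg i U)) (tensorId ι (kingGOp L aS 0 (kk i) (L ^ kk i) (Mn i)))
              (dressedOp (tensorId ι (kingGOp L aS 0 (kk i) (L ^ kk i) (Mn i))) (fun μ => tensorId ι (kingDOp L aS 0 (kk i) (L ^ kk i) (Mn i) μ)) (Vc i (avg i U)))) p p'|
            ≤ τ * ((L : ℝ) ^ kk i) ^ (-(γ / 2)) * Real.exp (-(δP * tdist (Mn i) p.1 p'.1))) := by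
  obtain ⟨β, δ, m₀, hβ, hδ, hm₀, HU⟩ := tensorId_massless_letters (d := d) ι hLodd hL2 haS hγ0.le hγ1
  obtain ⟨K, a₁, hK, ha₁, HV⟩ := hV
  obtain ⟨r₀, o₀, a₂, hr₀, ho₀, ha₂, HFs⟩ := hF
  have hLr : (0 : ℝ) ≤ (L : ℝ) := Nat.cast_nonneg _
  -- the Combes–Thomas row sum at `σ = δ∕2`, the threshold on `s = M_sz·α₀`
  set cr : ℝ := latticeConst (d + 1) (δ / 2) with hcr_def
  have hcr : 0 ≤ cr := latticeConst_nonneg _ (by positivity)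
  set a₁' : ℝ := min (min a₁ a₂) (1 / (2 * β * K * cr + 1)) with ha₁'_def
  have hden : 0 < 2 * β * K * cr + 1 := by positivity
  have ha₁' : 0 < a₁' := lt_min (lt_min ha₁ ha₂) (by positivity)
  have ha₁'a₁ : a₁' ≤ a₁ := (min_le_left _ _).trans (min_le_left _ _)
  have ha₁'a₂ : a₁' ≤ a₂ := (min_le_left _ _).trans (min_le_right _ _)
  have hguard : β * (K * a₁') * cr ≤ 1 / 2 := by
    have h1 : a₁' ≤ 1 / (2 * β * K * cr + 1) := min_le_right _ _
    have h2 : β * K * cr * a₁' ≤ β * K * cr * (1 / (2 * β * K * cr + 1)) := mul_le_mul_of_nonneg_left h1 (by positivity)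
    have h3 : β * K * cr * (1 / (2 * β * K * cr + 1)) ≤ 1 / 2 := by
      rw [mul_one_div, div_le_iff₀ hden]; nlinarith [mul_nonneg (mul_nonneg hβ.le hK) hcr]
    nlinarith
  obtain ⟨B, hBdef⟩ : ∃ B : ℝ, B = 2 * β := ⟨_, rfl⟩
  obtain ⟨ε, hεdef⟩ : ∃ ε : ℝ, ε = 2 * β ^ 2 * K * cr + 1 := ⟨_, rfl⟩
  obtain ⟨mX, hmXdef⟩ : ∃ mX : ℝ, mX = bgConst β cr m₀ K a₁' := ⟨_, rfl⟩
  have hB0 : 0 ≤ B := by rw [hBdef]; positivity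
  have hε0 : 0 < ε := by rw [hεdef]; positivity
  have hmX0 : 0 ≤ mX := by rw [hmXdef]; exact bgConst_nonneg hβ.le hcr hm₀.le hK ha₁'.le
  -- part XXII §3 at the dressed coloured letters (stated at rate `δ∕2`)
  obtain ⟨R₁, hR₁def⟩ : ∃ R₁ : ℝ, R₁ = r₀ * a₂ := ⟨_, rfl⟩
  have hR₁ : 0 ≤ R₁ := by rw [hR₁def]; positivity
  refine siteLettersCF_of_sizedDressedLetters (L := L) ι Mn kk Msz (fun i => Tor (fine (L ^ kk i) (Mn i)) × ι) (fun i => Tor (fine (L ^ mm i * L ^ kk i) (Mn i)) × ι)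
    (fun i => liftMap (blockOf (L ^ kk i) (Mn i)) ι) (fun i => liftMap (underPtN L (kk i) (mm i) (Mn i)) ι) Bc Bf avg
    (fun i => tensorId ι (kingGOp L aS 0 (kk i) (L ^ kk i) (Mn i))) (fun i => tensorId ι (kingGOp L aS 0 (kk i + mm i) (L ^ mm i * L ^ kk i) (Mn i)))
    (fun i V => dressedOp (tensorId ι (kingGOp L aS 0 (kk i) (L ^ kk i) (Mn i))) (fun μ => tensorId ι (kingDOp L aS 0 (kk i) (L ^ kk i) (Mn i) μ)) (Vc i V))
    (fun i U => dressedOp (tensorId ι (kingGOp L aS 0 (kk i + mm i) (L ^ mm i * L ^ kk i) (Mn i))) (fun μ => tensorId ι (kingDOp L aS 0 (kk i + mm i) (L ^ mm i * L ^ kk i) (Mn i) μ))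
      (Vf i U))
    Fc Fsc Ff Fsf c35 (γP := γ / 2) (fun i => zero_le_one.trans (hMsz i)) (fun i => ?_)
    ⟨β, B, ε * 1, mX, m₀, r₀, o₀, δ / 2, a₁', hβ.le, hB0, by positivity, hmX0, hm₀.le, hr₀, ho₀, half_pos hδ, ha₁', fun i => ?_⟩
  · -- uniform fibres of the colour-lifted pairing
    obtain ⟨N, hN, hfib⟩ := card_fibre_underPtN_ne (L := L) (kk i) (mm i) (Mn i)
    refine ⟨N, hN, fun x => ?_⟩
    rw [← hfib x.1]
    refine Finset.card_bij (fun p _ => p.1) (fun p hp => ?_) (fun p₁ hp₁ p₂ hp₂ h => ?_) (fun x' hx' => ?_)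
    · have hp' := (Literature.MathematicalPhysics.QuantumFieldTheory.Balaban1983to89.T4EtaRateCoeffDefect.mem_fibre _ _ _).1 hp
      exact (Literature.MathematicalPhysics.QuantumFieldTheory.Balaban1983to89.T4EtaRateCoeffDefect.mem_fibre _ _ _).2 (congrArg Prod.fst hp')
    · have h1 := (Literature.MathematicalPhysics.QuantumFieldTheory.Balaban1983to89.T4EtaRateCoeffDefect.mem_fibre _ _ _).1 hp₁
      have h2 := (Literature.MathematicalPhysics.QuantumFieldTheory.Balaban1983to89.T4EtaRateCoeffDefect.mem_fibre _ _ _).1 hp₂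
      have e1 : p₁.2 = x.2 := congrArg Prod.snd h1
      have e2 : p₂.2 = x.2 := congrArg Prod.snd h2
      exact Prod.ext h (e1.trans e2.symm)
    · refine ⟨(x', x.2), (Literature.MathematicalPhysics.QuantumFieldTheory.Balaban1983to89.T4EtaRateCoeffDefect.mem_fibre _ _ _).2 ?_, rfl⟩
      have hx'' := (Literature.MathematicalPhysics.QuantumFieldTheory.Balaban1983to89.T4EtaRateCoeffDefect.mem_fibre _ _ _).1 hx'
      exact Prod.ext hx'' rfl
  obtain ⟨hG, hD, hG', hD', hDG, hDD⟩ := HU (kk i) (hk i) (mm i) (hm i) (mT i) (Mn i) (hMnT i) (Msz i)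
  -- carrier facts
  have htri := triangle254_unitTorusGeo L (kk i) (Mn i)
  have hrow := rowSum_unitTorusGeo L (kk i) (Mn i) (half_pos hδ)
  have hd : ∀ a b : (unitTorusGeoS L (kk i) (Mn i) (Msz i)).Site, 0 ≤ (unitTorusGeoS L (kk i) (Mn i) (Msz i)).dist a b := fun a b => tdistT_nonneg (Mn i) a b
  have hθ : 0 ≤ ((L : ℝ) ^ kk i) ^ (-(γ / 2)) := Real.rpow_nonneg (pow_nonneg hLr _) _
  -- the letters at rate `δ∕2`
  have wk : ∀ {C : ℝ}, 0 ≤ C → ∀ y y' : Tor (Mn i), C * Real.exp (-(δ * tdistT (Mn i) y y')) ≤ C * Real.exp (-(δ / 2 * (unitTorusGeoS L (kk i) (Mn i) (Msz i)).dist y y')) :=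
    fun hC y y' => mul_le_mul_of_nonneg_left (Real.exp_le_exp.mpr (neg_le_neg (by
      rw [unitTorusGeoS_dist]; nlinarith [tdistT_nonneg (Mn i) y y', hδ]))) hC
  have hGc2 := hG.mono (wk hβ.le)
  have hGf2 := hG'.mono (wk hβ.le)
  have hDG2 := hDG.mono (wk (mul_nonneg hm₀.le hθ))
  refine ⟨hGc2, hGf2, hDG2, fun α₀ hα₀ hsa U hreg => ?_⟩
  -- the smallness parameter of the index `s = M_sz i·α₀`
  have hs0 : 0 < Msz i * α₀ := mul_pos (lt_of_lt_of_le one_pos (hMsz i)) hα₀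
  have hsa₁ : Msz i * α₀ ≤ a₁ := hsa.trans ha₁'a₁
  have hsa₂ : Msz i * α₀ ≤ a₂ := hsa.trans ha₁'a₂
  obtain ⟨hVc, hVf, hDV⟩ := HV i α₀ hα₀ hsa₁ U hreg
  obtain ⟨hF1, hF2, hF3, hF4, hF5, hF6⟩ := HFs i α₀ hα₀ hsa₂ U hreg
  have hR : 0 ≤ K * (Msz i * α₀) := mul_nonneg hK hs0.le
  have hq : β * (K * (Msz i * α₀)) * cr ≤ 1 / 2 := (mul_le_mul_of_nonneg_right (mul_le_mul_of_nonneg_left (mul_le_mul_of_nonneg_left hsa hK) hβ.le) hcr).trans hguard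
  have hq1 : β * (K * (Msz i * α₀)) * cr < 1 := by linarith
  have hinv : (1 - β * (K * (Msz i * α₀)) * cr)⁻¹ ≤ 2 := inv_one_sub_le_two hq
  have hinv0 : 0 ≤ (1 - β * (K * (Msz i * α₀)) * cr)⁻¹ := inv_nonneg.2 (by linarith)
  have hρδ : δ / 2 + δ / 2 ≤ δ := by linarith
  -- S4's three dressing theorems on the coloured block maps `liftBlk blockOf ι`, coarse and fine
  have hXc := hasMaj_dressedOp (g := unitTorusGeoS L (kk i) (Mn i) (Msz i)) (liftBlk (blockOf (L ^ kk i) (Mn i)) ι) htri hd hrow (by positivity) (by positivity : (0 : ℝ) ≤ δ / 2)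
    hρδ hβ.le hR hG hD hVc hq1
  have hXf := hasMaj_dressedOp (g := unitTorusGeoS L (kk i) (Mn i) (Msz i)) (liftBlk (blockOf (L ^ kk i) (Mn i) ∘ underPtN L (kk i) (mm i) (Mn i)) ι) htri hd hrow (by positivity)
    (by positivity : (0 : ℝ) ≤ δ / 2) hρδ hβ.le hR hG' hD' hVf hq1
  have hEc := hasMaj_dressedOp_sub (g := unitTorusGeoS L (kk i) (Mn i) (Msz i)) (liftBlk (blockOf (L ^ kk i) (Mn i)) ι) htri hd hrow (by positivity) (by positivity : (0 : ℝ) ≤ δ / 2)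
    hρδ hβ.le hR hG hD hVc hq1
  have hEf := hasMaj_dressedOp_sub (g := unitTorusGeoS L (kk i) (Mn i) (Msz i)) (liftBlk (blockOf (L ^ kk i) (Mn i) ∘ underPtN L (kk i) (mm i) (Mn i)) ι) htri hd hrow (by positivity)
    (by positivity : (0 : ℝ) ≤ δ / 2) hρδ hβ.le hR hG' hD' hVf hq1
  have hDX := hasMaj_idef_dressedOp (g := unitTorusGeoS L (kk i) (Mn i) (Msz i)) (liftBlk (blockOf (L ^ kk i) (Mn i)) ι) (liftMap (underPtN L (kk i) (mm i) (Mn i)) ι) htri hd hrow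
    (by positivity) hcr (K := K) (a₀ := Msz i * α₀) (by linarith : δ / 2 ≤ δ) hβ.le hm₀.le hθ hq hR le_rfl hG hD hG' hD' hDG hDD hVc hVf hDV
  have hXc2 : HasMaj (BlockNorm.ofBlocks (unitTorusGeoS L (kk i) (Mn i) (Msz i)) (liftBlk (blockOf (L ^ kk i) (Mn i)) ι))
      (BlockNorm.ofBlocks (unitTorusGeoS L (kk i) (Mn i) (Msz i)) (liftBlk (blockOf (L ^ kk i) (Mn i)) ι))
      (dressedOp (tensorId ι (kingGOp L aS 0 (kk i) (L ^ kk i) (Mn i))) (fun μ => tensorId ι (kingDOp L aS 0 (kk i) (L ^ kk i) (Mn i) μ)) (Vc i (avg i U)))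
      (fun y y' => B * Real.exp (-(δ / 2 * (unitTorusGeoS L (kk i) (Mn i) (Msz i)).dist y y'))) :=
    hXc.mono fun y y' => mul_le_mul_of_nonneg_right (by nlinarith [mul_le_mul_of_nonneg_left hinv hβ.le]) (Real.exp_nonneg _)
  have hXf2 : HasMaj (BlockNorm.ofBlocks (unitTorusGeoS L (kk i) (Mn i) (Msz i)) (liftBlk (blockOf (L ^ kk i) (Mn i) ∘ underPtN L (kk i) (mm i) (Mn i)) ι))
      (BlockNorm.ofBlocks (unitTorusGeoS L (kk i) (Mn i) (Msz i)) (liftBlk (blockOf (L ^ kk i) (Mn i) ∘ underPtN L (kk i) (mm i) (Mn i)) ι))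
      (dressedOp (tensorId ι (kingGOp L aS 0 (kk i + mm i) (L ^ mm i * L ^ kk i) (Mn i))) (fun μ => tensorId ι (kingDOp L aS 0 (kk i + mm i) (L ^ mm i * L ^ kk i) (Mn i) μ)) (Vf i U))
      (fun y y' => B * Real.exp (-(δ / 2 * (unitTorusGeoS L (kk i) (Mn i) (Msz i)).dist y y'))) :=
    hXf.mono fun y y' => mul_le_mul_of_nonneg_right (by nlinarith [mul_le_mul_of_nonneg_left hinv hβ.le]) (Real.exp_nonneg _)
  have hamp : β * (K * (Msz i * α₀) * (β * (1 - β * (K * (Msz i * α₀)) * cr)⁻¹)) * cr ≤ ε * 1 * (Msz i * α₀) := by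
    have h1 : β * (K * (Msz i * α₀) * (β * (1 - β * (K * (Msz i * α₀)) * cr)⁻¹)) * cr = (β * β * K * cr * (1 - β * (K * (Msz i * α₀)) * cr)⁻¹) * (Msz i * α₀) := by ring
    rw [h1, mul_one]
    refine mul_le_mul_of_nonneg_right ?_ hs0.le
    rw [hεdef]
    nlinarith [mul_le_mul_of_nonneg_left hinv (show 0 ≤ β * β * K * cr by positivity)]
  have hEc2 : HasMaj (BlockNorm.ofBlocks (unitTorusGeoS L (kk i) (Mn i) (Msz i)) (liftBlk (blockOf (L ^ kk i) (Mn i)) ι))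
      (BlockNorm.ofBlocks (unitTorusGeoS L (kk i) (Mn i) (Msz i)) (liftBlk (blockOf (L ^ kk i) (Mn i)) ι))
      (dressedOp (tensorId ι (kingGOp L aS 0 (kk i) (L ^ kk i) (Mn i))) (fun μ => tensorId ι (kingDOp L aS 0 (kk i) (L ^ kk i) (Mn i) μ)) (Vc i (avg i U))
        - tensorId ι (kingGOp L aS 0 (kk i) (L ^ kk i) (Mn i)))
      (fun y y' => ε * 1 * (Msz i * α₀) * Real.exp (-(δ / 2 * (unitTorusGeoS L (kk i) (Mn i) (Msz i)).dist y y'))) :=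
    hEc.mono fun y y' => mul_le_mul_of_nonneg_right hamp (Real.exp_nonneg _)
  have hEf2 : HasMaj (BlockNorm.ofBlocks (unitTorusGeoS L (kk i) (Mn i) (Msz i)) (liftBlk (blockOf (L ^ kk i) (Mn i) ∘ underPtN L (kk i) (mm i) (Mn i)) ι))
      (BlockNorm.ofBlocks (unitTorusGeoS L (kk i) (Mn i) (Msz i)) (liftBlk (blockOf (L ^ kk i) (Mn i) ∘ underPtN L (kk i) (mm i) (Mn i)) ι))
      (dressedOp (tensorId ι (kingGOp L aS 0 (kk i + mm i) (L ^ mm i * L ^ kk i) (Mn i))) (fun μ => tensorId ι (kingDOp L aS 0 (kk i + mm i) (L ^ mm i * L ^ kk i) (Mn i) μ)) (Vf i U)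
        - tensorId ι (kingGOp L aS 0 (kk i + mm i) (L ^ mm i * L ^ kk i) (Mn i)))
      (fun y y' => ε * 1 * (Msz i * α₀) * Real.exp (-(δ / 2 * (unitTorusGeoS L (kk i) (Mn i) (Msz i)).dist y y'))) :=
    hEf.mono fun y y' => mul_le_mul_of_nonneg_right hamp (Real.exp_nonneg _)
  have hDX2 : HasMaj (BlockNorm.ofBlocks (unitTorusGeoS L (kk i) (Mn i) (Msz i)) (liftBlk (blockOf (L ^ kk i) (Mn i)) ι))
      (BlockNorm.ofBlocks (unitTorusGeoS L (kk i) (Mn i) (Msz i)) (liftBlk (blockOf (L ^ kk i) (Mn i) ∘ underPtN L (kk i) (mm i) (Mn i)) ι))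
      (idef (pull (liftMap (underPtN L (kk i) (mm i) (Mn i)) ι)) (pull (liftMap (underPtN L (kk i) (mm i) (Mn i)) ι))
        (dressedOp (tensorId ι (kingGOp L aS 0 (kk i + mm i) (L ^ mm i * L ^ kk i) (Mn i))) (fun μ => tensorId ι (kingDOp L aS 0 (kk i + mm i) (L ^ mm i * L ^ kk i) (Mn i) μ)) (Vf i U))
        (dressedOp (tensorId ι (kingGOp L aS 0 (kk i) (L ^ kk i) (Mn i))) (fun μ => tensorId ι (kingDOp L aS 0 (kk i) (L ^ kk i) (Mn i) μ)) (Vc i (avg i U))))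
      (fun y y' => mX * ((L : ℝ) ^ kk i) ^ (-(γ / 2)) * Real.exp (-(δ / 2 * (unitTorusGeoS L (kk i) (Mn i) (Msz i)).dist y y'))) := by
    refine hDX.mono fun y y' => ?_
    have hsub : δ - δ / 2 = δ / 2 := by ring
    rw [hsub]
    exact mul_le_mul_of_nonneg_right (mul_le_mul_of_nonneg_right ((bgConst_mono_a₀ hβ.le hcr hm₀.le hK hsa).trans_eq hmXdef.symm) hθ) (Real.exp_nonneg _)
  exact ⟨hXc2, hXf2, hEc2, hEf2, hDX2, hF1, hF2, hF3, hF4, hF5, hF6⟩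

end LettersMF

/-! ## §2 ★★★ `NE2PlusSite` for every colour entry, both species live -/

section SocketMF

variable (ι : Type) [Fintype ι] [DecidableEq ι] (Mn : I → Fin (d + 1) → ℕ) [hMn0 : ∀ i μ, NeZero (Mn i μ)] (kk mm : I → ℕ) (Msz : I → ℝ) (X : I → Type) [∀ i, Fintype (X i)]
  (blk : ∀ i, X i → Tor (Mn i)) (gf : I → B9.Geometry) (Bc Bf : I → B9.Backgrounds)
  (Vc : ∀ i, (Bc i).Cfg → (((Tor (fine (L ^ kk i) (Mn i)) × ι) × Option (Fin (d + 1)) → ℝ) →ₗ[ℝ] (Tor (fine (L ^ kk i) (Mn i)) × ι → ℝ)))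
  (Vf : ∀ i, (Bf i).Cfg → (((Tor (fine (L ^ mm i * L ^ kk i) (Mn i)) × ι) × Option (Fin (d + 1)) → ℝ) →ₗ[ℝ] (Tor (fine (L ^ mm i * L ^ kk i) (Mn i)) × ι → ℝ)))
  (Fc : ∀ i, (Bc i).Cfg → (Tor (fine (L ^ kk i) (Mn i)) × ι → ℝ) →ₗ[ℝ] (Tor (Mn i) × ι → ℝ)) (Fsc : ∀ i, (Bc i).Cfg → (Tor (Mn i) × ι → ℝ) →ₗ[ℝ] (Tor (fine (L ^ kk i) (Mn i)) × ι → ℝ))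
  (Ff : ∀ i, (Bf i).Cfg → (Tor (fine (L ^ mm i * L ^ kk i) (Mn i)) × ι → ℝ) →ₗ[ℝ] (Tor (Mn i) × ι → ℝ))
  (Fsf : ∀ i, (Bf i).Cfg → (Tor (Mn i) × ι → ℝ) →ₗ[ℝ] (Tor (fine (L ^ mm i * L ^ kk i) (Mn i)) × ι → ℝ))

/-- ★★★ **`NE2PlusSite`, EVERY COLOUR ENTRY, COLOUR-MIXING SPECIES AND COLOURED AVERAGING SPECIES BOTH LIVE, SIZE LIVE, FROM THE TWO SPECIES' SIZED LETTERS ALONE** — part XXI's coloured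
socket ∘ §1. [cite: Balaban1985BackgroundPropagators, Thm 3.2 (3.48) p.398 + Thm 3.14 pp.426–427 (quantifier template), (3.52) p.400, (3.58) p.402, (3.63)–(3.67) pp.402–403 (mechanism); Balaban1984PropagatorsI, (1.45) p.26; King1986, Prop. 3.8 (3.71) p.664; CombesThomas1973, §II] -/
theorem ne2PlusSite_cSiteExOn_of_sizedSpeciesLettersMF (hLodd : Odd L) (hL2 : 2 ≤ L) {aS : ℝ} (haS : 0 < aS) (c35 : ℝ) (d' : ℕ) (p : ℝ) {γ : ℝ} (hγ0 : 0 < γ) (hγ1 : γ < 1)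
    {mT : I → ℕ} (hMnT : ∀ i μ, Mn i μ = 2 * L ^ mT i) (hk : ∀ i, 1 ≤ kk i) (hm : ∀ i, 1 ≤ mm i) (hMsz : ∀ i, 1 ≤ Msz i)
    (pair : ∀ i, EtaPairing (opGeo (unitTorusGeoS L (kk i) (Mn i) (Msz i)) (X i) (blk i)) (gf i) (Bc i) (Bf i))
    (hV : ∃ K a₁ : ℝ, 0 ≤ K ∧ 0 < a₁ ∧ ∀ (i : I) (α₀ : ℝ), 0 < α₀ → Msz i * α₀ ≤ a₁ → ∀ U : (Bf i).Cfg, (Bf i).Reg335 c35 α₀ U →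
      HasMaj (BlockNorm.ofBlocks (unitTorusGeoS L (kk i) (Mn i) (Msz i)) (blkPair (liftBlk (blockOf (L ^ kk i) (Mn i)) ι)))
        (BlockNorm.ofBlocks (unitTorusGeoS L (kk i) (Mn i) (Msz i)) (liftBlk (blockOf (L ^ kk i) (Mn i)) ι)) (Vc i ((pair i).avg U)) (diagK fun _ => K * (Msz i * α₀)) ∧
      HasMaj (BlockNorm.ofBlocks (unitTorusGeoS L (kk i) (Mn i) (Msz i)) (blkPair (liftBlk (blockOf (L ^ kk i) (Mn i) ∘ underPtN L (kk i) (mm i) (Mn i)) ι)))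
        (BlockNorm.ofBlocks (unitTorusGeoS L (kk i) (Mn i) (Msz i)) (liftBlk (blockOf (L ^ kk i) (Mn i) ∘ underPtN L (kk i) (mm i) (Mn i)) ι)) (Vf i U)
        (diagK fun _ => K * (Msz i * α₀)) ∧
      HasMaj (BlockNorm.ofBlocks (unitTorusGeoS L (kk i) (Mn i) (Msz i)) (blkPair (liftBlk (blockOf (L ^ kk i) (Mn i)) ι)))
        (BlockNorm.ofBlocks (unitTorusGeoS L (kk i) (Mn i) (Msz i)) (liftBlk (blockOf (L ^ kk i) (Mn i) ∘ underPtN L (kk i) (mm i) (Mn i)) ι))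
        (idef (pull (liftPair (liftMap (underPtN L (kk i) (mm i) (Mn i)) ι))) (pull (liftMap (underPtN L (kk i) (mm i) (Mn i)) ι)) (Vf i U) (Vc i ((pair i).avg U)))
        (diagK fun _ => K * (Msz i * α₀) * ((L : ℝ) ^ kk i) ^ (-(γ / 2))))
    (hF : ∃ r₀ o₀ a₂ : ℝ, 0 ≤ r₀ ∧ 0 ≤ o₀ ∧ 0 < a₂ ∧ ∀ (i : I) (α₀ : ℝ), 0 < α₀ → Msz i * α₀ ≤ a₂ → ∀ U : (Bf i).Cfg, (Bf i).Reg335 c35 α₀ U →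
      HasMaj (BlockNorm.ofBlocks (unitTorusGeoS L (kk i) (Mn i) (Msz i)) (liftBlk (blockOf (L ^ kk i) (Mn i)) ι)) (BlockNorm.ofBlocks (unitTorusGeoS L (kk i) (Mn i) (Msz i)) (fun p : Tor (Mn i) × ι => p.1))
        (Fc i ((pair i).avg U)) (diagK fun _ => r₀ * (Msz i * α₀)) ∧
      HasMaj (BlockNorm.ofBlocks (unitTorusGeoS L (kk i) (Mn i) (Msz i)) (fun p : Tor (Mn i) × ι => p.1)) (BlockNorm.ofBlocks (unitTorusGeoS L (kk i) (Mn i) (Msz i)) (liftBlk (blockOf (L ^ kk i) (Mn i)) ι))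
        (Fsc i ((pair i).avg U)) (diagK fun _ => r₀ * (Msz i * α₀)) ∧
      HasMaj (BlockNorm.ofBlocks (unitTorusGeoS L (kk i) (Mn i) (Msz i)) (liftBlk (blockOf (L ^ kk i) (Mn i) ∘ underPtN L (kk i) (mm i) (Mn i)) ι))
        (BlockNorm.ofBlocks (unitTorusGeoS L (kk i) (Mn i) (Msz i)) (fun p : Tor (Mn i) × ι => p.1)) (Ff i U) (diagK fun _ => r₀ * (Msz i * α₀)) ∧
      HasMaj (BlockNorm.ofBlocks (unitTorusGeoS L (kk i) (Mn i) (Msz i)) (fun p : Tor (Mn i) × ι => p.1))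
        (BlockNorm.ofBlocks (unitTorusGeoS L (kk i) (Mn i) (Msz i)) (liftBlk (blockOf (L ^ kk i) (Mn i) ∘ underPtN L (kk i) (mm i) (Mn i)) ι)) (Fsf i U) (diagK fun _ => r₀ * (Msz i * α₀)) ∧
      HasMaj (BlockNorm.ofBlocks (unitTorusGeoS L (kk i) (Mn i) (Msz i)) (liftBlk (blockOf (L ^ kk i) (Mn i)) ι)) (BlockNorm.ofBlocks (unitTorusGeoS L (kk i) (Mn i) (Msz i)) (fun p : Tor (Mn i) × ι => p.1))
        (idef (pull (liftMap (underPtN L (kk i) (mm i) (Mn i)) ι)) LinearMap.id (Ff i U) (Fc i ((pair i).avg U))) (diagK fun _ => o₀ * ((L : ℝ) ^ kk i) ^ (-(γ / 2))) ∧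
      HasMaj (BlockNorm.ofBlocks (unitTorusGeoS L (kk i) (Mn i) (Msz i)) (fun p : Tor (Mn i) × ι => p.1))
        (BlockNorm.ofBlocks (unitTorusGeoS L (kk i) (Mn i) (Msz i)) (liftBlk (blockOf (L ^ kk i) (Mn i) ∘ underPtN L (kk i) (mm i) (Mn i)) ι))
        (idef LinearMap.id (pull (liftMap (underPtN L (kk i) (mm i) (Mn i)) ι)) (Fsf i U) (Fsc i ((pair i).avg U))) (diagK fun _ => o₀ * ((L : ℝ) ^ kk i) ^ (-(γ / 2))))
    (c c' : I → ι) :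
    NE2PlusSite d' p c35 (fun i => (⟨opGeo (unitTorusGeoS L (kk i) (Mn i) (Msz i)) (X i) (blk i), gf i, Bc i, Bf i, pair i⟩ : PairedInstance))
      (cSiteExOn ι Mn kk mm Msz X blk gf Bc Bf aS pair
        (fun i U => siteEntriesC (Mn i) ι (sitePertCF (Mn i) ι (liftMap (blockOf (L ^ kk i) (Mn i) ∘ underPtN L (kk i) (mm i) (Mn i)) ι) (Ff i U) (Fsf i U)
          (tensorId ι (kingGOp L aS 0 (kk i + mm i) (L ^ mm i * L ^ kk i) (Mn i)))
          (dressedOp (tensorId ι (kingGOp L aS 0 (kk i + mm i) (L ^ mm i * L ^ kk i) (Mn i))) (fun μ => tensorId ι (kingDOp L aS 0 (kk i + mm i) (L ^ mm i * L ^ kk i) (Mn i) μ))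
            (Vf i U))))
        (fun i V => siteEntriesC (Mn i) ι (sitePertCF (Mn i) ι (liftMap (blockOf (L ^ kk i) (Mn i)) ι) (Fc i V) (Fsc i V) (tensorId ι (kingGOp L aS 0 (kk i) (L ^ kk i) (Mn i)))
          (dressedOp (tensorId ι (kingGOp L aS 0 (kk i) (L ^ kk i) (Mn i))) (fun μ => tensorId ι (kingDOp L aS 0 (kk i) (L ^ kk i) (Mn i) μ)) (Vc i V))))
        c c') := by
  have hgM : ∀ i, (gf i).M = Msz i := fun i => (pair i).M_eq
  have hM : ∀ i, 1 ≤ (gf i).M := fun i => (hgM i).symm ▸ hMsz i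
  obtain ⟨δP, ζ, τ, a₁, hδP, hζ, hτ, ha₁, HP⟩ :=
    siteLettersCF_of_sizedSpeciesLettersM (L := L) ι Mn kk mm Msz Bc Bf (fun i => (pair i).avg) Vc Vf Fc Fsc Ff Fsf hLodd hL2 haS c35 hγ0 hγ1 hMnT hk hm hMsz hV hF
  refine ne2PlusSite_cSiteExOn_of_sizedLetters ι Mn kk mm Msz X blk gf Bc Bf hLodd hL2 haS c35 d' p hMnT hk hM pair _ _ (half_pos hγ0)
    ⟨δP, ζ, τ, a₁, hδP, hζ, hτ, ha₁, fun i α₀ hα₀ hMα U hreg => ?_⟩ c c'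
  rw [hgM i] at hMα ⊢
  exact HP i α₀ hα₀ hMα U hreg

end SocketMF

end Summit.QuantumFields.YangMills.BalabanUVNodes.N15.SiteLayerBg

end
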